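import Mathlib.RingTheory.Filtration
import Literature.NumberTheory.EllipticCurves.McCallum1991.HigherLevelKolyvaginClasses
import Literature.NumberTheory.EllipticCurves.MordellWeilTheoremProofs
import Literature.NumberTheory.EllipticCurves.Wuthrich2014.ThreeAdicImageOrdinaryProofs
import Literature.NumberTheory.EllipticCurves.BSDSelmerSkinnerProofs
import Summits.BirchSwinnertonDyer.BirchSwinnertonDyer.Theorems.ClassRecordThreeEulerHalvesAtThreeJetchevMaxOfPerLevel
import Summits.BirchSwinnertonDyer.BirchSwinnertonDyer.Theorems.Rank1ResidualJetRingClassFields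
import HarnessLib

/-!
# Kolyvagin's redefinition of `m_∞` — the `hK` input of `jetchevMaxHLAtThree_of_perLevel` (p486881) —
# DERIVED from the typed McCallum 1991 Prop. 5.2 (`McCallum1991.prop52_exists_conductor_kolyvaginClass_order_eq`,
# cell `bsd-jet`, seat lit-ty), Mordell–Weil (a tree THEOREM) and a conductor-1 datum with `y_K` of
# infinite order; hence `stub_jetchevMaxHLAtThree` VERBATIM ⟸ {Prop. 5.2 fact, `y_K` non-torsion
# per frame, the per-level inequality} (cell `bsd-stepL`, seat
# `bsd-stepL-tam3-p1`, helper toward item 19109 `EulerHalvesAtThree`)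

HONEST FRAMING. CONDITIONAL bricks: `exists_mInf_of_prop52` and its corollaries take the named,
UNPROVED Literature fact `McCallum1991.prop52_exists_conductor_kolyvaginClass_order_eq` (McCallum,
LMS LN 153 (1991) §5 Prop. 5.2, case `C = {0}`, typed 2026-08-27 by `bsd-jet-lit-ty`; p-adic tower
image; NO `p ∤ N` clause) as a hypothesis; nothing is discharged unconditionally; the registered stub
`stub_jetchevMaxHLAtThree` (item 19109, skeleton v4) stays OPEN; no item closes; 0 classes move
(T7); `--supports stmt-BirchSwinnertonDyer-19109` (helper). WHAT IS PROVED: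
* §1 `exists_exactDepth_of_not_isOfFinAddOrder` — in a finitely generated abelian group an element
  of infinite order has an exact `p`-depth (`p^u ∣ x`, `p^{u+1} ∤ x`): Krull's intersection theorem
  (`Ideal.mem_iInf_smul_pow_eq_bot_iff`) + injectivity of `n ↦ n • x`. [folklore]
* §2 `divOrd_eq_natCast_of_exact` ∕ `exact_of_divOrd_eq_natCast` — `p^u ∥ P_n ⟺ ord_p(P_n) = u`
  for the tree's `Koly.divOrd` (x11b3 `KolyvaginLine.lean`).
* §3 **`exists_mInf_of_prop52`** (any odd `p`): under Prop. 5.2's own binders (globally minimal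
  `W/ℚ` without CM; `K` imaginary quadratic, `d_K ∉ {−3,−4}`, Heegner hypothesis; `p ≠ 2` with
  surjective `p`-adic tower; frame `(Dt, β, ι)`; ring class fields number fields; a conductor-1
  datum `d₁` with `P_1 = y_K` of infinite order) there is `m_∞ : ℕ` with `m_∞ ≤ m(n)` for every
  admissible `(n, d)` and attained at admissible conductors of arbitrarily large `M(n)`, where
  `m(n) := ord_p(P_n)` if `ord_p(P_n) < M(n)`, else `∞` (McCallum's convention) — EXACTLY the
  binder `hK` of `jetchevMaxHLAtThree_of_perLevel`. PROOF: `m_∞ := min` of the set of exact depths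
  `u` over admissible data with `u + 1 ≤ M(n)` — non-empty by `d₁` (Mordell–Weil
  `module_finite_point_holds` on `E(K[1])` + §1; `M(1) = ∞`); the bound by `Nat.sInf_le`; attainment:
  at the minimiser `n₀` either `n₀ = 1` (serves every bound, `M(1) = ∞`) or `n₀` has `r ≥ 1` prime
  factors, `m_∞` is McCallum's `M_r` (`IsLeast` on `S_r`), and Prop. 5.2 with `M = max(m', M_r + 1)`
  gives `n ∈ S_r(M)` with `p^{M_r} ∥ P_n`, i.e. `m(n) = m_∞`, `M(n) ≥ m'`.
* §4 `jetchevMaxHLAtThree_hK_of_prop52` — at every frame of the stub (`p = 3 ∥ N`), Prop. 5.2's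
  binders FROM the frame: `¬CM` (`not_hasCM_of_hasMultiplicativeReductionAtPrime'`), `d_K ≠ −3`
  (`3 ∣ N` + Heegner ⟹ `3 ∤ d_K`), `d_K ≠ −4` (`d_K` odd), the 3-adic tower
  (`forall_hasSurjectiveModNGaloisRep_pow_of_multiplicative_of_surj`, Wuthrich 2014 Lemma 20); `K[k]`
  number fields for ALL `k` (bsd-jet's `JET.numberField_ringClassField`, pv-2's
  `Rank1ResidualJetRingClassFields.lean`, including the junk conductor `k = 0`); ONE input remains: `hy` (a conductor-1 datum with `y_K` of infinite order: Gross–Zagier grade on the frame,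
  `r_an = 1`, `L(E^{d_K},1) ≠ 0`; `gross_zagier` is conjunct 1 of item 19112).
* §5 **`jetchevMaxHLAtThree_of_prop52_of_perLevel : h52 → hy → hlev → ‹stub_jetchevMaxHLAtThree
  verbatim›`** — so the reading-grade stub now reads, in the tree: {S9 = ONE typed fact (Prop. 5.2),
  `y_K` non-torsion per frame (GZ), `hlev` = the per-level inequality, i.e. the
  instantiation of `JET.Section6.tamagawaExponent_le_m_of_selmerFamilies` (S1∕S2∕S3∕S4∕S5∕S7∕S10 of
  the `bsd-jet` sheet `PV2-J6-KERNEL.md`)}.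
References (locators only; the one cited FACT is imported, not declared): [cite: McCallumLMS1991,
§5 Lemma 5.1, Prop. 5.2 (pp. 303–306)] [cite: Jetchev2008, §3.1 (p. 817), Thm. 1.4 (p. 812), Proof
of Thm. 1.4 (p. 825)] [cite: Wuthrich2014, Lemma 20 (p. 399)] [cite: SilvermanAEC2009, Thm. VIII.6.7].
Design: theorems only; `ℕ∞`. Axioms: `propext`, `Classical.choice`, `Quot.sound`.
-/

set_option autoImplicit false

noncomputable section

open scoped Classical NumberField

namespace Summit.BirchSwinnertonDyer.Rank1Residual.X11b.Three.Koly

open WeierstrassCurve Literature.NumberTheory.EllipticCurves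
  Literature.NumberTheory.EllipticCurves.ModularForms
  Literature.NumberTheory.EllipticCurves.Rank1Residual
  Summit.BirchSwinnertonDyer.Rank1Residual Summit.BirchSwinnertonDyer.Rank1Residual.X11b
  IsDedekindDomain

universe u

/-! ### §1 An element of infinite order in a finitely generated abelian group has an exact `p`-depth -/

/-- In a finitely generated abelian group, an element `x` of infinite order is not infinitely
`p`-divisible (`1 < p`): there is `u` with `p^u ∣ x` and `p^{u+1} ∤ x`. PROOF: otherwise
`x ∈ ⋂ᵢ pⁱ·A`, so by Krull's intersection theorem (`Ideal.mem_iInf_smul_pow_eq_bot_iff`, `ℤ`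
Noetherian, `A` finite over `ℤ`) `r • x = x` for some `r ∈ (p)`, i.e. `(1 − r) • x = 0` with
`1 − r ≠ 0` — contradicting the injectivity of `n ↦ n • x`. [folklore] -/
theorem exists_exactDepth_of_not_isOfFinAddOrder {A : Type*} [AddCommGroup A] [Module.Finite ℤ A]
    {p : ℕ} (hp : 1 < p) {x : A} (hx : ¬ IsOfFinAddOrder x) :
    ∃ u : ℕ, (∃ Q : A, ((p ^ u : ℕ) : ℤ) • Q = x) ∧ ¬ ∃ Q : A, ((p ^ (u + 1) : ℕ) : ℤ) • Q = x := by
  by_contra hall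
  push Not at hall
  -- every depth is attained
  have hdiv : ∀ u : ℕ, ∃ Q : A, ((p ^ u : ℕ) : ℤ) • Q = x := by
    intro u
    induction u with
    | zero => exact ⟨x, by simp⟩
    | succ u ih => exact hall u ih
  -- hence `x ∈ ⋂ᵢ (p)ⁱ • ⊤`
  set I : Ideal ℤ := Ideal.span {(p : ℤ)} with hI
  have hmem : x ∈ (⨅ i : ℕ, I ^ i • ⊤ : Submodule ℤ A) := by
    rw [Submodule.mem_iInf]
    intro i
    obtain ⟨Q, hQ⟩ := hdiv i
    rw [← hQ]
    have hpi : ((p ^ i : ℕ) : ℤ) ∈ I ^ i := by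
      rw [Nat.cast_pow]
      exact Ideal.pow_mem_pow (Ideal.mem_span_singleton_self (p : ℤ)) i
    exact Submodule.smul_mem_smul hpi (Submodule.mem_top : Q ∈ (⊤ : Submodule ℤ A))
  obtain ⟨⟨r, hr⟩, hrx⟩ := (Ideal.mem_iInf_smul_pow_eq_bot_iff I x).mp hmem
  obtain ⟨k, rfl⟩ := Ideal.mem_span_singleton'.mp hr
  -- `(1 - k p) • x = 0` with `n ↦ n • x` injective
  have hinj := injective_zsmul_iff_not_isOfFinAddOrder.mpr hx
  have h0 : (1 - k * (p : ℤ)) • x = (0 : ℤ) • x := by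
    rw [sub_smul, one_smul, zero_smul, sub_eq_zero]
    exact hrx.symm
  have h1 : (1 : ℤ) - k * p = 0 := hinj h0
  have hdvd : (p : ℤ) ∣ 1 := ⟨k, by linarith⟩
  have : p ∣ 1 := by exact_mod_cast hdvd
  exact absurd (Nat.le_of_dvd Nat.one_pos this) (not_le.mpr hp)

/-! ### §2 `ord_p(P_n) = u` exactly, in the tree's `ℕ∞` currency -/

section Depth

variable {N : ℕ} [NeZero N] {W : WeierstrassCurve ℚ} {K : Type u} [Field K] [NumberField K]
  {Dt : ModularParametrizationData W N} {β : ℤ} {ι : K →+* ℂ}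

/-- `p^u | P_n` and `p^{u+1} ∤ P_n` give `ord_p(P_n) = u` (`Koly.divOrd`). [cite: McCallumLMS1991, §5 (p. 303)] -/
theorem divOrd_eq_natCast_of_exact {n : ℕ} (d : KolyvaginHeegnerData Dt β ι n) (p : ℕ) {u : ℕ}
    (hu : PDiv d p u) (hu' : ¬ PDiv d p (u + 1)) : divOrd d p = (u : ℕ∞) :=
  le_antisymm (divOrd_le_of_not_pDiv d p hu')
    (le_iSup₂ (f := fun (M : ℕ) (_ : PDiv d p M) ↦ (M : ℕ∞)) u hu)

/-- Conversely `ord_p(P_n) = u` gives `p^u | P_n` and `p^{u+1} ∤ P_n`. [cite: McCallumLMS1991, §5 (p. 303)] -/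
theorem exact_of_divOrd_eq_natCast {n : ℕ} (d : KolyvaginHeegnerData Dt β ι n) (p : ℕ) {u : ℕ}
    (h : divOrd d p = (u : ℕ∞)) : PDiv d p u ∧ ¬ PDiv d p (u + 1) := by
  refine ⟨pDiv_of_le_divOrd d p u h.ge, fun h' => ?_⟩
  have : ((u + 1 : ℕ) : ℕ∞) ≤ divOrd d p :=
    le_iSup₂ (f := fun (M : ℕ) (_ : PDiv d p M) ↦ (M : ℕ∞)) (u + 1) h'
  rw [h] at this
  have : u + 1 ≤ u := by exact_mod_cast this
  omega

end Depth

/-! ### §3 Kolyvagin's redefinition of `m_∞` from McCallum's Prop. 5.2 (any odd `p`) -/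

/-- **Kolyvagin's redefinition of `m_∞` with its finiteness, from the typed McCallum 1991 Prop. 5.2.**
Under the binders of `McCallum1991.prop52_exists_conductor_kolyvaginClass_order_eq` (globally
minimal `W/ℚ` without CM, `K` imaginary quadratic with `d_K ∉ {−3, −4}` and the Heegner hypothesis,
`p` odd with surjective `p`-adic tower, a frame `(Dt, β, ι)`, ring class fields number fields, a
conductor-1 datum `d₁` with `P_1 = y_K` of infinite order): with McCallum's
`m(n) := ord_p(P_n)` if `ord_p(P_n) < M(n)`, else `∞` (`Koly.divOrd`, `Zhang2014.levelIndex`), there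
is a natural number `m_∞` with `m_∞ ≤ m(n)` for every ADMISSIBLE `(n, d)` (square-free product of
Kolyvagin primes, any datum) which is ATTAINED at admissible conductors of arbitrarily large `M(n)`
— exactly the binder `hK` of `jetchevMaxHLAtThree_of_perLevel` at the frame. PROOF: `m_∞ := min`
of the set `U` of exact depths `u` (`p^u ∥ P_n`, `u + 1 ≤ M(n)`) over admissible data — non-empty by
`d₁` (Mordell–Weil: `E(K[1])` is finitely generated, so `y_K` of infinite order has an exact depth;
`M(1) = ∞`); if the minimum is attained at `n = 1` it serves every bound (`M(1) = ∞`), otherwise at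
some `n` with `r ≥ 1` prime factors, where `m_∞ = M_r` (McCallum's least exact depth on `S_r`) and
Prop. 5.2 with `M := max(m', M_r + 1)` supplies `n' ∈ S_r(M)` with `p^{M_r} ∥ P_{n'}`.
[cite: McCallumLMS1991, §5 Lemma 5.1, Prop. 5.2 (pp. 303–306)]
[cite: Jetchev2008, Proof of Thm. 1.4 (arXiv p0017) = printed Proof of Thm. 1.1 (p. 824)] -/
theorem exists_mInf_of_prop52
    (h52 : McCallum1991.prop52_exists_conductor_kolyvaginClass_order_eq)
    (W : WeierstrassCurve ℚ) [W.IsElliptic] [W.IsGloballyMinimal] [NeZero (W.conductorNorm ℤ)]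
    (hcm : ¬ W.HasCM) (K : Type) [Field K] [NumberField K] (hK : IsImaginaryQuadratic K)
    (hD3 : NumberField.discr K ≠ -3) (hD4 : NumberField.discr K ≠ -4)
    (hH : SatisfiesHeegnerHypothesis (W.conductorNorm ℤ) K)
    (p : ℕ) [Fact p.Prime] (hp2 : p ≠ 2) (htower : ∀ n : ℕ, W.HasSurjectiveModNGaloisRep (p ^ n : ℕ))
    (Dt : ModularParametrizationData W (W.conductorNorm ℤ)) (β : ℤ) (ι : K →+* ℂ)
    [∀ k : ℕ, NumberField (ringClassField K ι k)]
    (d₁ : KolyvaginHeegnerData Dt β ι 1) (hy : ¬ IsOfFinAddOrder d₁.derivedPoint) :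
    ∃ mInf : ℕ,
      (∀ (n : ℕ) (d : KolyvaginHeegnerData Dt β ι n), Squarefree n →
        (∀ ℓ ∈ n.primeFactors, Zhang2014.IsKolyvaginPrime (W.conductorNorm ℤ) W K p ℓ) →
        (mInf : ℕ∞) ≤ (if divOrd d p < Zhang2014.levelIndex W p n then divOrd d p else ⊤)) ∧
      (∀ m' : ℕ, ∃ (n : ℕ) (d : KolyvaginHeegnerData Dt β ι n), Squarefree n ∧
        (∀ ℓ ∈ n.primeFactors, Zhang2014.IsKolyvaginPrime (W.conductorNorm ℤ) W K p ℓ) ∧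
        (m' : ℕ∞) ≤ Zhang2014.levelIndex W p n ∧
        (if divOrd d p < Zhang2014.levelIndex W p n then divOrd d p else (⊤ : ℕ∞)) = mInf) := by
  have hp : p.Prime := Fact.out
  -- the set of exact depths over admissible data, and its `r`-slices (McCallum's sets)
  let U : Set ℕ := {u | ∃ (n : ℕ) (d : KolyvaginHeegnerData Dt β ι n), Squarefree n ∧
    (∀ ℓ ∈ n.primeFactors, Zhang2014.IsKolyvaginPrime (W.conductorNorm ℤ) W K p ℓ ∧
      u + 1 ≤ Zhang2014.kolyvaginIndex W p ℓ) ∧ PDiv d p u ∧ ¬ PDiv d p (u + 1)}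
  -- `U` is non-empty: the exact depth of `y_K = P_1` (Mordell–Weil)
  haveI : Module.Finite ℤ (W.baseChange (ringClassField K ι 1)).toAffine.Point := by
    -- (the `DecidableEq` instance on the field used by the group law is irrelevant: subsingleton)
    convert (W.baseChange (ringClassField K ι 1)).module_finite_point_holds
  obtain ⟨u₀, hu₀, hu₀'⟩ := exists_exactDepth_of_not_isOfFinAddOrder hp.one_lt hy
  have hU0 : u₀ ∈ U := ⟨1, d₁, squarefree_one, by simp, hu₀, hu₀'⟩
  have hUne : U.Nonempty := ⟨u₀, hU0⟩
  -- `m_∞ := min U`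
  obtain ⟨n₀, d₀, hn₀, hℓ₀, hdiv₀, hndiv₀⟩ := Nat.sInf_mem hUne
  refine ⟨sInf U, ?_, ?_⟩
  · -- (i) `m_∞ ≤ m(n)` on admissible data
    intro n d hn hℓ
    by_cases hlt : divOrd d p < Zhang2014.levelIndex W p n
    · rw [if_pos hlt]
      have hne : divOrd d p ≠ ⊤ := ne_top_of_lt hlt
      obtain ⟨u, hu⟩ : ∃ u : ℕ, divOrd d p = (u : ℕ∞) := ⟨(divOrd d p).toNat, (ENat.coe_toNat hne).symm⟩
      obtain ⟨hdu, hndu⟩ := exact_of_divOrd_eq_natCast d p hu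
      have hidx : ∀ ℓ ∈ n.primeFactors, u + 1 ≤ Zhang2014.kolyvaginIndex W p ℓ := by
        rw [← Zhang2014.natCast_le_levelIndex_iff]
        rw [hu] at hlt
        exact Order.add_one_le_of_lt (by exact_mod_cast hlt)
      have huU : u ∈ U := ⟨n, d, hn, fun ℓ h => ⟨hℓ ℓ h, hidx ℓ h⟩, hdu, hndu⟩
      rw [hu]
      exact_mod_cast Nat.sInf_le huU
    · rw [if_neg hlt]; exact le_top
  · -- (ii) attainment at arbitrarily large `M(n)`
    intro m'
    by_cases hr : n₀.primeFactors.card = 0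
    · -- the minimum is attained at `n₀ = 1`: `M(1) = ∞`
      have hn1 : n₀ = 1 := by
        rcases Nat.primeFactors_eq_empty.mp (Finset.card_eq_zero.mp hr) with h | h
        · exact absurd h hn₀.ne_zero
        · exact h
      subst hn1
      refine ⟨1, d₀, squarefree_one, by simp, by simp [Zhang2014.levelIndex_one], ?_⟩
      have hdo : divOrd d₀ p = ((sInf U : ℕ) : ℕ∞) := divOrd_eq_natCast_of_exact d₀ p hdiv₀ hndiv₀
      have hlt : divOrd d₀ p < Zhang2014.levelIndex W p 1 := by
        rw [Zhang2014.levelIndex_one, hdo]; exact ENat.coe_lt_top _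
      rw [if_pos hlt, hdo]
    · -- `r ≥ 1`: McCallum's Prop. 5.2 on `S_r`, `M_r = m_∞`
      set r := n₀.primeFactors.card with hrdef
      have hrpos : 0 < r := Nat.pos_of_ne_zero hr
      have hMr : IsLeast {u : ℕ | ∃ (n : ℕ) (d : KolyvaginHeegnerData Dt β ι n), Squarefree n ∧
          n.primeFactors.card = r ∧
          (∀ ℓ ∈ n.primeFactors, Zhang2014.IsKolyvaginPrime (W.conductorNorm ℤ) W K p ℓ ∧
            u + 1 ≤ Zhang2014.kolyvaginIndex W p ℓ) ∧
          (∃ Q : (W.baseChange (ringClassField K ι n)).toAffine.Point,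
            ((p ^ u : ℕ) : ℤ) • Q = d.derivedPoint) ∧
          ¬ ∃ Q : (W.baseChange (ringClassField K ι n)).toAffine.Point,
            ((p ^ (u + 1) : ℕ) : ℤ) • Q = d.derivedPoint} (sInf U) := by
        refine ⟨⟨n₀, d₀, hn₀, rfl, hℓ₀, hdiv₀, hndiv₀⟩, ?_⟩
        rintro u ⟨n, d, hn, -, hℓ, hdu, hndu⟩
        exact Nat.sInf_le ⟨n, d, hn, hℓ, hdu, hndu⟩
      obtain ⟨n, d, hn, -, hℓ, -, hdiv, hndiv⟩ :=
        h52 W hcm K hK hD3 hD4 hH p hp2 htower Dt β ι d₁ hy r hrpos (sInf U) hMr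
          (max m' (sInf U + 1)) (lt_of_lt_of_le (Nat.lt_succ_self _) (le_max_right _ _))
      have hM : ((max m' (sInf U + 1) : ℕ) : ℕ∞) ≤ Zhang2014.levelIndex W p n :=
        Zhang2014.natCast_le_levelIndex_iff.mpr fun ℓ h => (hℓ ℓ h).2
      have hdo : divOrd d p = ((sInf U : ℕ) : ℕ∞) := divOrd_eq_natCast_of_exact d p hdiv hndiv
      have hlt : divOrd d p < Zhang2014.levelIndex W p n := by
        rw [hdo]
        refine lt_of_lt_of_le ?_ hM
        exact_mod_cast lt_of_lt_of_le (Nat.lt_succ_self _) (le_max_right _ _)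
      refine ⟨n, d, hn, fun ℓ h => (hℓ ℓ h).1, ?_, by rw [if_pos hlt, hdo]⟩
      exact le_trans (by exact_mod_cast le_max_left _ _) hM

/-! ### §4 At the stub's frames (`p = 3 ∥ N`): `hK` from Prop. 5.2 + `y_K` of infinite order -/

/-- **The `hK` binder of `jetchevMaxHLAtThree_of_perLevel` from McCallum's Prop. 5.2 and a
conductor-1 datum with `y_K` of infinite order, at every frame of `stub_jetchevMaxHLAtThree`.** The
frame gives Prop. 5.2's binders: `¬CM` (multiplicative at 3, `not_hasCM_of_hasMultiplicativeReductionAtPrime'`),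
`d_K ≠ −3` (`3 ∣ N` and the Heegner hypothesis make `3 ∤ d_K`), `d_K ≠ −4` (`d_K` odd), the
3-adic tower (`forall_hasSurjectiveModNGaloisRep_pow_of_multiplicative_of_surj`, Wuthrich Lemma 20),
ring class fields number fields (`JET.numberField_ringClassField`, `Rank1ResidualJetRingClassFields.lean`).
The remaining per-frame input `hy` — SOME conductor-1 datum has `P_1 = y_K` of infinite order — is
Gross–Zagier grade (`L'(E/K,1) ≠ 0` on the frame; `gross_zagier`, item 19112 conjunct 1) and stays
a hypothesis.
[cite: McCallumLMS1991, §5 Prop. 5.2 (p. 304)] [cite: Wuthrich2014, Lemma 20 (p. 399)] -/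
theorem jetchevMaxHLAtThree_hK_of_prop52
    (h52 : McCallum1991.prop52_exists_conductor_kolyvaginClass_order_eq)
    (hy : ∀ (W : WeierstrassCurve ℚ) [W.IsElliptic] [W.IsGloballyMinimal] [NeZero (W.conductorNorm ℤ)]
      (K : Type) [Field K] [NumberField K]
      (Dt : ModularParametrizationData W (W.conductorNorm ℤ)) (β : ℤ) (ι : K →+* ℂ),
      W.analyticRank = 1 → W.HasMultiplicativeReductionAtPrime 3 → Surj W 3 →
      IsImaginaryQuadratic K → SatisfiesHeegnerHypothesis (W.conductorNorm ℤ) K →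
      Odd (NumberField.discr K) → (W.quadraticTwist (NumberField.discr K : ℚ)).entireLFunction 1 ≠ 0 →
      (4 * (W.conductorNorm ℤ : ℤ)) ∣ β ^ 2 - NumberField.discr K → ¬ (3 : ℤ) ∣ Dt.c →
      ∃ d₁ : KolyvaginHeegnerData Dt β ι 1, ¬ IsOfFinAddOrder d₁.derivedPoint)
    (W : WeierstrassCurve ℚ) [W.IsElliptic] [W.IsGloballyMinimal] [NeZero (W.conductorNorm ℤ)]
    (K : Type) [Field K] [NumberField K]
    (Dt : ModularParametrizationData W (W.conductorNorm ℤ)) (β : ℤ) (ι : K →+* ℂ)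
    (hr : W.analyticRank = 1) (hmult : W.HasMultiplicativeReductionAtPrime 3) (hρ : Surj W 3)
    (hK : IsImaginaryQuadratic K) (hHN : SatisfiesHeegnerHypothesis (W.conductorNorm ℤ) K)
    (hodd : Odd (NumberField.discr K))
    (hLt : (W.quadraticTwist (NumberField.discr K : ℚ)).entireLFunction 1 ≠ 0)
    (hβ : (4 * (W.conductorNorm ℤ : ℤ)) ∣ β ^ 2 - NumberField.discr K) (hc : ¬ (3 : ℤ) ∣ Dt.c) :
    ∃ mInf : ℕ,
      (∀ (n : ℕ) (d : KolyvaginHeegnerData Dt β ι n), Squarefree n →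
        (∀ ℓ ∈ n.primeFactors, Zhang2014.IsKolyvaginPrime (W.conductorNorm ℤ) W K 3 ℓ) →
        (mInf : ℕ∞) ≤ (if divOrd d 3 < Zhang2014.levelIndex W 3 n then divOrd d 3 else ⊤)) ∧
      (∀ m' : ℕ, ∃ (n : ℕ) (d : KolyvaginHeegnerData Dt β ι n), Squarefree n ∧
        (∀ ℓ ∈ n.primeFactors, Zhang2014.IsKolyvaginPrime (W.conductorNorm ℤ) W K 3 ℓ) ∧
        (m' : ℕ∞) ≤ Zhang2014.levelIndex W 3 n ∧
        (if divOrd d 3 < Zhang2014.levelIndex W 3 n then divOrd d 3 else (⊤ : ℕ∞)) = mInf) := by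
  obtain ⟨d₁, hy₁⟩ := hy W K Dt β ι hr hmult hρ hK hHN hodd hLt hβ hc
  -- Prop. 5.2's binders from the frame
  have hcm : ¬ W.HasCM := not_hasCM_of_hasMultiplicativeReductionAtPrime' W hmult
  have h3split : SatisfiesHeegnerHypothesis 3 K :=
    SatisfiesHeegnerHypothesis.of_dvd (dvd_conductorNorm_of_mult (W := W) hmult) hHN
  have hpd : ¬ ((3 : ℕ) : ℤ) ∣ NumberField.discr K :=
    not_dvd_discr_of_split hK Nat.prime_three (by norm_num) h3split
  have hD3 : NumberField.discr K ≠ -3 := fun h ↦ hpd (h ▸ ⟨-1, by norm_num⟩)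
  have hD4 : NumberField.discr K ≠ -4 := by
    rintro h; rw [h] at hodd; exact absurd hodd (by decide)
  have htower : ∀ n : ℕ, W.HasSurjectiveModNGaloisRep (3 ^ n : ℕ) :=
    forall_hasSurjectiveModNGaloisRep_pow_of_multiplicative_of_surj W 3 (by norm_num) hmult hρ
  haveI : ∀ k : ℕ, NumberField (ringClassField K ι k) :=
    Summit.BirchSwinnertonDyer.Rank1Residual.JET.numberField_ringClassField K hK ι
  exact exists_mInf_of_prop52 h52 W hcm K hK hD3 hD4 hHN 3 (by norm_num) htower Dt β ι d₁ hy₁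


/-! ### §5 The stub from {McCallum Prop. 5.2 (typed), `y_K` of infinite order per frame, the
per-level inequality} -/

/-- **`stub_jetchevMaxHLAtThree` VERBATIM from: the typed McCallum 1991 Prop. 5.2
(`McCallum1991.prop52_exists_conductor_kolyvaginClass_order_eq`, S9), a conductor-1 datum with `y_K`
of infinite order at every frame (`hy`, Gross–Zagier grade) and the per-level inequality (`hlev`, the output of
`JET.Section6.tamagawaExponent_le_m_of_selmerFamilies` once instantiated).** Composition of
`jetchevMaxHLAtThree_hK_of_prop52` with `jetchevMaxHLAtThree_of_perLevel` (p486881). Nothing is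
discharged unconditionally; the stub stays open; 0 classes move.
[cite: McCallumLMS1991, §5 Prop. 5.2 (p. 304)] [cite: Jetchev2008, Thm. 1.4 (p. 812), Proof of Thm. 1.4 (p. 825)] -/
theorem jetchevMaxHLAtThree_of_prop52_of_perLevel
    (h52 : McCallum1991.prop52_exists_conductor_kolyvaginClass_order_eq)
    (hy : ∀ (W : WeierstrassCurve ℚ) [W.IsElliptic] [W.IsGloballyMinimal] [NeZero (W.conductorNorm ℤ)]
      (K : Type) [Field K] [NumberField K]
      (Dt : ModularParametrizationData W (W.conductorNorm ℤ)) (β : ℤ) (ι : K →+* ℂ),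
      W.analyticRank = 1 → W.HasMultiplicativeReductionAtPrime 3 → Surj W 3 →
      IsImaginaryQuadratic K → SatisfiesHeegnerHypothesis (W.conductorNorm ℤ) K →
      Odd (NumberField.discr K) → (W.quadraticTwist (NumberField.discr K : ℚ)).entireLFunction 1 ≠ 0 →
      (4 * (W.conductorNorm ℤ : ℤ)) ∣ β ^ 2 - NumberField.discr K → ¬ (3 : ℤ) ∣ Dt.c →
      ∃ d₁ : KolyvaginHeegnerData Dt β ι 1, ¬ IsOfFinAddOrder d₁.derivedPoint)
    (hlev : ∀ (W : WeierstrassCurve ℚ) [W.IsElliptic] [W.IsGloballyMinimal] [NeZero (W.conductorNorm ℤ)]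
      (K : Type) [Field K] [NumberField K]
      (Dt : ModularParametrizationData W (W.conductorNorm ℤ)) (β : ℤ) (ι : K →+* ℂ),
      W.analyticRank = 1 → W.HasMultiplicativeReductionAtPrime 3 → Surj W 3 →
      IsImaginaryQuadratic K → SatisfiesHeegnerHypothesis (W.conductorNorm ℤ) K →
      Odd (NumberField.discr K) → (W.quadraticTwist (NumberField.discr K : ℚ)).entireLFunction 1 ≠ 0 →
      (4 * (W.conductorNorm ℤ : ℤ)) ∣ β ^ 2 - NumberField.discr K → ¬ (3 : ℤ) ∣ Dt.c →
      ∀ (v : HeightOneSpectrum (𝓞 ℚ)) (k n : ℕ) (d : KolyvaginHeegnerData Dt β ι n), Squarefree n →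
        (∀ ℓ ∈ n.primeFactors, Zhang2014.IsKolyvaginPrime (W.conductorNorm ℤ) W K 3 ℓ) →
        (if divOrd d 3 < Zhang2014.levelIndex W 3 n then divOrd d 3 else (⊤ : ℕ∞)) < (k : ℕ∞) →
        padicValNat 3 (W.tamagawaNumberAt v) ≤ k →
        (k : ℕ∞) + (if divOrd d 3 < Zhang2014.levelIndex W 3 n then divOrd d 3 else ⊤) ≤
          Zhang2014.levelIndex W 3 n →
        (padicValNat 3 (W.tamagawaNumberAt v) : ℕ∞) ≤
          (if divOrd d 3 < Zhang2014.levelIndex W 3 n then divOrd d 3 else ⊤)) :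
    ∀ (W : WeierstrassCurve ℚ) [W.IsElliptic] [W.IsGloballyMinimal] [NeZero (W.conductorNorm ℤ)]
      (K : Type) [Field K] [NumberField K]
      (Dt : ModularParametrizationData W (W.conductorNorm ℤ)) (β : ℤ) (ι : K →+* ℂ),
      W.analyticRank = 1 → W.HasMultiplicativeReductionAtPrime 3 → Surj W 3 →
      IsImaginaryQuadratic K → SatisfiesHeegnerHypothesis (W.conductorNorm ℤ) K →
      Odd (NumberField.discr K) → (W.quadraticTwist (NumberField.discr K : ℚ)).entireLFunction 1 ≠ 0 →
      (4 * (W.conductorNorm ℤ : ℤ)) ∣ β ^ 2 - NumberField.discr K → ¬ (3 : ℤ) ∣ Dt.c →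
      ∀ (v : HeightOneSpectrum (𝓞 ℚ)) (s : ℕ), s ≤ padicValNat 3 (W.tamagawaNumberAt v) →
        ∀ (n : ℕ) (d : KolyvaginHeegnerData Dt β ι n), Squarefree n →
          (∀ ℓ ∈ n.primeFactors, Zhang2014.IsKolyvaginPrime (W.conductorNorm ℤ) W K 3 ℓ ∧
            s ≤ Zhang2014.kolyvaginIndex W 3 ℓ) → PDiv d 3 s :=
  jetchevMaxHLAtThree_of_perLevel
    (fun W _ _ _ K _ _ Dt β ι hr hmult hρ hK hHN hodd hLt hβ hc =>
      jetchevMaxHLAtThree_hK_of_prop52 h52 hy W K Dt β ι hr hmult hρ hK hHN hodd hLt hβ hc)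
    hlev

end Summit.BirchSwinnertonDyer.Rank1Residual.X11b.Three.Koly

end
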